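/-
Copyright (c) 2026. All rights reserved.
Released under Apache 2.0 license as described in the file LICENSE.
Authors: HodgeCM publication cell (pub-hodgecm), DAG-node prover lineage #13 (gen 4: statements and proofs;
gen 7: tree port).
-/
import Mathlib.MeasureTheory.Function.L2Space
import Mathlib.MeasureTheory.Group.Measure
import Mathlib.MeasureTheory.Group.LIntegral
import Mathlib.Analysis.Complex.Circle
import Mathlib.Topology.ContinuousMap.Algebra

/-!
# The Schrödinger system on `L²(X, μ)`: translations, modulations, and the Heisenberg commutation relation

Topic `RepresentationTheory/HeisenbergGroup`; namespace `Literature.RepresentationTheory.HeisenbergGroup.SchrodingerLevi`.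
For a topological abelian group `X` with a left-invariant measure `μ` we CONSTRUCT, as unitary operators on
`L²(X, μ) = Lp ℂ 2 μ`, the translations `translate μ x : f ↦ f(· + x)` (`x ∈ X`) and the modulations
`modulate μ c : f ↦ c · f` by a continuous unimodular multiplier `c ∈ C(X, S¹)`, prove their group laws, and the
**Heisenberg commutation relation** `translate_modulate_of_char`: for a unitary CHARACTER `χ`
(`χ(u + v) = χ(u) χ(v)`), `τ_x M_χ = χ(x) • M_χ τ_x`.

Source.  C. Mœglin, M.-F. Vignéras, J.-L. Waldspurger, *Correspondances de Howe sur un corps p-adique*, LNM 1291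
(1987) [MoeglinVignerasWaldspurger1987], Chap. 2: I.2 (Heisenberg group `H = H(W)` and its smooth irreducible
representation with central character `ψ`), I.3 (the models `S_A` by right translations) and I.4 Exemple (1)
(held text `book:moeglinnd-correspondances-de-howe-sur-un-corps-p`, chunk p0031 L19): for a complete polarisation
`W = X + Y`, "`ρ((x+y,t)) f(y') = ψ(⟨y',x⟩ + ⟨y,x⟩/2 + t) f(y+y')`" — i.e. the Schrödinger representation is
generated by the TRANSLATIONS `f ↦ f(· + y)` and the MODULATIONS by the characters `y' ↦ ψ(⟨y', x⟩)`, the centre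
acting by the scalars `ψ(t)`.  We realise these operators on `L²` (the unitary completion; A. Weil, Acta Math. 111
(1964) [Weil1964], Chap. I) for an ARBITRARY family of multipliers `c ∈ C(X, S¹)`; taking `c` among the unitary
characters gives the Heisenberg operators.

WHAT IS REPRODUCED (kernel proofs from Mathlib only):
* §1 the continuous self-maps `addRight x = (· + x)` and `smulMap g = (g • ·)` of `X`;
* §2 `translate μ x : Lp ℂ 2 μ ≃ₗᵢ[ℂ] Lp ℂ 2 μ`, `translate_mul_translate : τ_x τ_y = τ_{x+y}`, `translate_zero`;
* §3 `modulate μ c : Lp ℂ 2 μ ≃ₗᵢ[ℂ] Lp ℂ 2 μ`, `modulate_mul_modulate : M_c M_{c'} = M_{cc'}`, `modulate_one`;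
* §4 `translate_modulate : τ_x M_c = M_{c(· + x)} τ_x` and the Heisenberg relation `translate_modulate_of_char`.

Design: `translate` is Mathlib's `Lp.compMeasurePreserving` along `(· + x)`; `modulate` is multiplication by a
`Circle`-valued continuous map, so no integrability issue arises.  NOT here: the Heisenberg group as a group
object, the conjugation of the system by the Levi dilations and its rigidity (`LeviRigidity.lean`), the
irreducibility of the system (Stone–von Neumann: `StoneVonNeumann*.lean` in this directory).

Provenance: tree port (LEAN-IN-TREE, 2026-08-18) of §2.1–§2.3 of the HodgeCM publication cell's package file
`HodgeCM/PerL34/LocalFactors/SchrodingerLevi.lean` (unit `pub-hodgecm-pv13-g4`, gate run 27; statements and proofs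
verbatim, namespace `HodgeCM.PerL34.LocalFactors.SchrodingerLevi` ↦
`Literature.RepresentationTheory.HeisenbergGroup.SchrodingerLevi`).
-/

set_option autoImplicit false

noncomputable section

open MeasureTheory MeasureTheory.Measure Set Complex
open scoped ENNReal NNReal Pointwise InnerProductSpace

namespace Literature.RepresentationTheory.HeisenbergGroup.SchrodingerLevi

/-! ## §1 Two continuous self-maps of `X` -/

section Maps

variable {X : Type*} [TopologicalSpace X]

/-- the shift `u ↦ u + x` as a continuous self-map of `X`. [folklore] -/
def addRight [Add X] [ContinuousAdd X] (x : X) : C(X, X) := ⟨fun u => u + x, continuous_id.add continuous_const⟩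

/-- `addRight x u = u + x`. [folklore] -/
@[simp] theorem addRight_apply [Add X] [ContinuousAdd X] (x u : X) : addRight x u = u + x := rfl

/-- the action map `u ↦ g • u` as a continuous self-map of `X`. [folklore] -/
def smulMap {G : Type*} [SMul G X] [ContinuousConstSMul G X] (g : G) : C(X, X) :=
  ⟨fun u => g • u, continuous_const_smul g⟩

/-- `smulMap g u = g • u`. [folklore] -/
@[simp] theorem smulMap_apply {G : Type*} [SMul G X] [ContinuousConstSMul G X] (g : G) (u : X) :
    smulMap g u = g • u := rfl

end Maps

section Schrodinger

variable {X : Type*} [TopologicalSpace X] [MeasurableSpace X] [BorelSpace X]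

section Translation

variable [AddCommGroup X] [IsTopologicalAddGroup X] (μ : Measure X) [μ.IsAddLeftInvariant]

/-! ## §2 Translations -/

/-- the translate `u ↦ f (u + x)` of an `L²` class (Mathlib's composition with the measure-preserving `(· + x)`).
[cite: MoeglinVignerasWaldspurger1987, Chap. 2 I.3] -/
def translateFun (x : X) (f : Lp ℂ 2 μ) : Lp ℂ 2 μ :=
  Lp.compMeasurePreserving (fun u : X => u + x) (measurePreserving_add_right μ x) f

/-- `translateFun μ x f = f(· + x)` almost everywhere. [folklore] -/
theorem coeFn_translateFun (x : X) (f : Lp ℂ 2 μ) :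
    ⇑(translateFun μ x f) =ᵐ[μ] fun u => f (u + x) :=
  Lp.coeFn_compMeasurePreserving f _

/-- translation preserves the `L²` norm. [folklore] -/
theorem norm_translateFun (x : X) (f : Lp ℂ 2 μ) : ‖translateFun μ x f‖ = ‖f‖ :=
  Lp.norm_compMeasurePreserving f _

/-- additivity of `translateFun μ x`. [folklore] -/
theorem translateFun_add (x : X) (f f' : Lp ℂ 2 μ) :
    translateFun μ x (f + f') = translateFun μ x f + translateFun μ x f' :=
  map_add (Lp.compMeasurePreserving (fun u : X => u + x) (measurePreserving_add_right μ x)) f f'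

/-- homogeneity of `translateFun μ x`. [folklore] -/
theorem translateFun_smul (x : X) (a : ℂ) (f : Lp ℂ 2 μ) :
    translateFun μ x (a • f) = a • translateFun μ x f :=
  map_smul (Lp.compMeasurePreservingₗ ℂ (fun u : X => u + x) (measurePreserving_add_right μ x)) a f

/-- `τ_x (τ_y f) = τ_{x + y} f`:  `f(u + x + y)`. [folklore] -/
theorem translateFun_translateFun (x y : X) (f : Lp ℂ 2 μ) :
    translateFun μ x (translateFun μ y f) = translateFun μ (x + y) f := by
  apply Lp.ext
  refine (coeFn_translateFun μ x _).trans (Filter.EventuallyEq.trans ?_ (coeFn_translateFun μ (x + y) f).symm)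
  have h := (measurePreserving_add_right μ x).quasiMeasurePreserving.ae_eq_comp (coeFn_translateFun μ y f)
  filter_upwards [h] with u hu
  simp only [Function.comp_apply] at hu
  rw [hu, add_assoc]

/-- `τ_0 = id`. [folklore] -/
theorem translateFun_zero (f : Lp ℂ 2 μ) : translateFun μ 0 f = f := by
  apply Lp.ext
  refine (coeFn_translateFun μ 0 f).trans ?_
  filter_upwards [] with u
  rw [add_zero]

/-- `τ_{-x}` is a left inverse of `τ_x`. [folklore] -/
theorem translateFun_neg_apply (x : X) (f : Lp ℂ 2 μ) : translateFun μ (-x) (translateFun μ x f) = f := by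
  rw [translateFun_translateFun, neg_add_cancel, translateFun_zero]

/-- **Translation** `τ_x : f ↦ f(· + x)`, a unitary operator on `L²(X, μ)` — with the character modulations,
the operators of the Schrödinger representation of the Heisenberg group.
[cite: MoeglinVignerasWaldspurger1987, Chap. 2 I.4 Ex. (1)] -/
def translate (x : X) : Lp ℂ 2 μ ≃ₗᵢ[ℂ] Lp ℂ 2 μ where
  toFun := translateFun μ x
  map_add' := translateFun_add μ x
  map_smul' := translateFun_smul μ x
  invFun := translateFun μ (-x)
  left_inv := translateFun_neg_apply μ x
  right_inv f := by simpa only [neg_neg] using translateFun_neg_apply μ (-x) f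
  norm_map' := norm_translateFun μ x

/-- `translate μ x f = translateFun μ x f`. [folklore] -/
@[simp] theorem translate_apply (x : X) (f : Lp ℂ 2 μ) : translate μ x f = translateFun μ x f := rfl

/-- `(τ_x f)(u) = f(u + x)` almost everywhere. [folklore] -/
theorem coeFn_translate (x : X) (f : Lp ℂ 2 μ) : ⇑(translate μ x f) =ᵐ[μ] fun u => f (u + x) :=
  coeFn_translateFun μ x f

/-- the translations form a representation of `X`: `τ_x τ_y = τ_{x+y}`. [folklore] -/
theorem translate_mul_translate (x y : X) : translate μ x * translate μ y = translate μ (x + y) :=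
  LinearIsometryEquiv.ext fun f => by
    rw [LinearIsometryEquiv.coe_mul, Function.comp_apply, translate_apply, translate_apply, translate_apply,
      translateFun_translateFun]

/-- `τ_0 = 1`. [folklore] -/
theorem translate_zero : translate μ (0 : X) = 1 :=
  LinearIsometryEquiv.ext fun f => by rw [translate_apply, translateFun_zero, LinearIsometryEquiv.one_def]; rfl

end Translation

section Modulation

variable (μ : Measure X)

/-! ## §3 Modulations -/

/-- `u ↦ c(u) f(u)` is square-integrable for a continuous unimodular multiplier `c`. [folklore] -/
theorem memLp_circle_mul (c : C(X, Circle)) (f : Lp ℂ 2 μ) : MemLp (fun u => (c u : ℂ) * f u) 2 μ :=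
  (Lp.memLp f).of_le
    (((continuous_subtype_val : Continuous ((↑) : Circle → ℂ)).comp c.continuous).aestronglyMeasurable.mul
      (Lp.aestronglyMeasurable f))
    (Filter.Eventually.of_forall fun u => by rw [norm_mul, Circle.norm_coe, one_mul])

/-- the modulated function `u ↦ c(u) f(u)` of an `L²` class, as an `L²` class.
[cite: MoeglinVignerasWaldspurger1987, Chap. 2 I.4 Ex. (1)] -/
def modulateFun (c : C(X, Circle)) (f : Lp ℂ 2 μ) : Lp ℂ 2 μ := (memLp_circle_mul μ c f).toLp _

/-- `modulateFun μ c f = c · f` almost everywhere. [folklore] -/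
theorem coeFn_modulateFun (c : C(X, Circle)) (f : Lp ℂ 2 μ) :
    ⇑(modulateFun μ c f) =ᵐ[μ] fun u => (c u : ℂ) * f u :=
  MemLp.coeFn_toLp _

/-- modulation by a unimodular multiplier preserves the `L²` norm. [folklore] -/
theorem norm_modulateFun (c : C(X, Circle)) (f : Lp ℂ 2 μ) : ‖modulateFun μ c f‖ = ‖f‖ := by
  rw [Lp.norm_def, Lp.norm_def, eLpNorm_congr_ae (coeFn_modulateFun μ c f)]
  congr 1
  exact eLpNorm_congr_norm_ae (Filter.Eventually.of_forall fun u => by rw [norm_mul, Circle.norm_coe, one_mul])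

/-- additivity of `modulateFun μ c`. [folklore] -/
theorem modulateFun_add (c : C(X, Circle)) (f f' : Lp ℂ 2 μ) :
    modulateFun μ c (f + f') = modulateFun μ c f + modulateFun μ c f' := by
  apply Lp.ext
  refine (coeFn_modulateFun μ c _).trans (Filter.EventuallyEq.trans ?_ (Lp.coeFn_add _ _).symm)
  filter_upwards [Lp.coeFn_add f f', coeFn_modulateFun μ c f, coeFn_modulateFun μ c f'] with u hu h1 h2
  simp only [Pi.add_apply, h1, h2, hu, mul_add]

/-- homogeneity of `modulateFun μ c`. [folklore] -/
theorem modulateFun_smul (c : C(X, Circle)) (a : ℂ) (f : Lp ℂ 2 μ) :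
    modulateFun μ c (a • f) = a • modulateFun μ c f := by
  apply Lp.ext
  refine (coeFn_modulateFun μ c _).trans (Filter.EventuallyEq.trans ?_ (Lp.coeFn_smul _ _).symm)
  filter_upwards [Lp.coeFn_smul a f, coeFn_modulateFun μ c f] with u hu h1
  simp only [Pi.smul_apply, h1, hu, smul_eq_mul]
  ring

/-- `M_c (M_{c'} f) = M_{c c'} f`. [folklore] -/
theorem modulateFun_modulateFun (c c' : C(X, Circle)) (f : Lp ℂ 2 μ) :
    modulateFun μ c (modulateFun μ c' f) = modulateFun μ (c * c') f := by
  apply Lp.ext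
  refine (coeFn_modulateFun μ c _).trans (Filter.EventuallyEq.trans ?_ (coeFn_modulateFun μ _ f).symm)
  filter_upwards [coeFn_modulateFun μ c' f] with u hu
  rw [hu, ContinuousMap.mul_apply, Circle.coe_mul, mul_assoc]

/-- `M_1 = id`. [folklore] -/
theorem modulateFun_one (f : Lp ℂ 2 μ) : modulateFun μ 1 f = f := by
  apply Lp.ext
  refine (coeFn_modulateFun μ 1 f).trans ?_
  filter_upwards [] with u
  rw [ContinuousMap.one_apply, Circle.coe_one, one_mul]

/-- `M_{c⁻¹}` is a left inverse of `M_c`. [folklore] -/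
theorem modulateFun_inv_apply (c : C(X, Circle)) (f : Lp ℂ 2 μ) :
    modulateFun μ c⁻¹ (modulateFun μ c f) = f := by
  rw [modulateFun_modulateFun, inv_mul_cancel, modulateFun_one]

/-- **Modulation** `M_c : f ↦ c · f` by a continuous unimodular function `c : X → S¹`, a unitary operator on
`L²(X, μ)`.  For `c = ψ(⟨·, ξ⟩)` a unitary character these are, with the translations, the operators of the
Schrödinger representation of the Heisenberg group `H(X ⊕ X*)`.
[cite: MoeglinVignerasWaldspurger1987, Chap. 2 I.4 Ex. (1)] -/
def modulate (c : C(X, Circle)) : Lp ℂ 2 μ ≃ₗᵢ[ℂ] Lp ℂ 2 μ where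
  toFun := modulateFun μ c
  map_add' := modulateFun_add μ c
  map_smul' := modulateFun_smul μ c
  invFun := modulateFun μ c⁻¹
  left_inv := modulateFun_inv_apply μ c
  right_inv f := by simpa only [inv_inv] using modulateFun_inv_apply μ c⁻¹ f
  norm_map' := norm_modulateFun μ c

/-- `modulate μ c f = modulateFun μ c f`. [folklore] -/
@[simp] theorem modulate_apply (c : C(X, Circle)) (f : Lp ℂ 2 μ) : modulate μ c f = modulateFun μ c f := rfl

/-- `(M_c f)(u) = c(u) f(u)` almost everywhere. [folklore] -/
theorem coeFn_modulate (c : C(X, Circle)) (f : Lp ℂ 2 μ) :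
    ⇑(modulate μ c f) =ᵐ[μ] fun u => (c u : ℂ) * f u :=
  coeFn_modulateFun μ c f

/-- the modulations form a representation of `C(X, S¹)`: `M_c M_{c'} = M_{c c'}`. [folklore] -/
theorem modulate_mul_modulate (c c' : C(X, Circle)) : modulate μ c * modulate μ c' = modulate μ (c * c') :=
  LinearIsometryEquiv.ext fun f => by
    rw [LinearIsometryEquiv.coe_mul, Function.comp_apply, modulate_apply, modulate_apply, modulate_apply,
      modulateFun_modulateFun]

/-- `M_1 = 1`. [folklore] -/
theorem modulate_one : modulate μ (1 : C(X, Circle)) = 1 :=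
  LinearIsometryEquiv.ext fun f => by rw [modulate_apply, modulateFun_one, LinearIsometryEquiv.one_def]; rfl

end Modulation

section Heisenberg

variable [AddCommGroup X] [IsTopologicalAddGroup X] (μ : Measure X) [μ.IsAddLeftInvariant]

/-! ## §4 The Heisenberg commutation relation -/

/-- `τ_x M_c = M_{c(· + x)} τ_x`. [folklore] -/
theorem translate_modulate (x : X) (c : C(X, Circle)) (f : Lp ℂ 2 μ) :
    translate μ x (modulate μ c f) = modulate μ (c.comp (addRight x)) (translate μ x f) := by
  apply Lp.ext
  refine (coeFn_translate μ x _).trans (Filter.EventuallyEq.trans ?_ (coeFn_modulate μ _ _).symm)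
  have h := (measurePreserving_add_right μ x).quasiMeasurePreserving.ae_eq_comp (coeFn_modulate μ c f)
  filter_upwards [h, coeFn_translate μ x f] with u hu h2
  simp only [Function.comp_apply] at hu
  rw [hu, h2, ContinuousMap.comp_apply, addRight_apply]

/-- **Heisenberg commutation relation**: for a unitary CHARACTER `χ` (`χ(u + v) = χ(u) χ(v)`),
`τ_x M_χ = χ(x) • M_χ τ_x` — translations and character modulations generate the Schrödinger representation of the
Heisenberg group, the centre acting by scalars. [cite: MoeglinVignerasWaldspurger1987, Chap. 2 I.4 Ex. (1)] -/
theorem translate_modulate_of_char (χ : C(X, Circle)) (hχ : ∀ u v, χ (u + v) = χ u * χ v) (x : X)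
    (f : Lp ℂ 2 μ) :
    translate μ x (modulate μ χ f) = (χ x : ℂ) • modulate μ χ (translate μ x f) := by
  rw [translate_modulate]
  apply Lp.ext
  refine (coeFn_modulate μ _ _).trans (Filter.EventuallyEq.trans ?_ (Lp.coeFn_smul _ _).symm)
  filter_upwards [coeFn_modulate μ χ (translate μ x f)] with u hu
  rw [Pi.smul_apply, hu, ContinuousMap.comp_apply, addRight_apply, hχ, Circle.coe_mul, smul_eq_mul]
  ring

end Heisenberg

end Schrodinger

end Literature.RepresentationTheory.HeisenbergGroup.SchrodingerLevi
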